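import Mathlib.RingTheory.Etale.Pi
import Literature.AlgebraicGeometry.Motives.EtaleToProetIndEtaleAlgebra
import HarnessLib

/-!
# Zariski localizations and ind-(Zariski localizations) are ind-étale (Bhatt–Scholze §2.2–2.3)

The residual hypothesis of `nonempty_addEquiv_sheafH_etaleToProetPullback_of_weaklyEtale_indEtale`
(`EtaleToProetIndEtaleAlgebra.lean`) is Bhatt–Scholze Thm. 2.3.4, whose printed proof ends: "Lemma
2.3.8 shows that `f'` is an ind-(Zariski localization). Setting `C = B'` then proves the claim."
This file supplies the notions and the step used there:

* `IsZariskiLocalization R S` — **Zariski localizations** ("`B = ∏_{i=1}^n A[1/fᵢ]`"), with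
  `isZariskiLocalization_away` and `IsZariskiLocalization.etale` (principal localizations and
  finite products of étale algebras are étale);
* `IsIndZariskiLocalization R S` — **ind-(Zariski localizations)** ("a filtered colimit of
  Zariski localizations"; directed colimits as in `IsIndEtale`), with
  `IsZariskiLocalization.isIndZariskiLocalization`;
* `IsIndZariskiLocalization.isIndEtale`, `IsIndZariskiLocalization.weaklyEtale_specMap` —
  **ind-(Zariski localizations) are ind-étale**, hence weakly étale.

## References

* B. Bhatt, P. Scholze, *The pro-étale topology for schemes*, Astérisque 369 (2015)
  (arXiv:1309.1198, held): §2.2 (definitions before Lemma 2.2.3, p. 9), Prop. 2.3.3,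
  Thm. 2.3.4 (proof, p. 12). [BhattScholze2015]

## Design notes

* Real definitions and theorems only (D-0026); same directed-colimit format as `IsIndEtale`.
* Mathlib searched/used: `Algebra.Etale.of_isLocalizationAway`, `Algebra.Etale` for finite
  products (`RingTheory/Etale/Pi.lean`), `Algebra.Etale.of_equiv`, `AlgEquiv.funUnique`.
  Nothing restated.
-/

universe u

open CategoryTheory

namespace Literature.AlgebraicGeometry.Motives

/-! ### Zariski localizations and ind-(Zariski localizations) (Bhatt–Scholze §2.2) -/

section Zariski

/-- **Zariski localizations** (Bhatt–Scholze §2.2: "A map `f : A → B` is called a Zariski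
localization if `B = ∏_{i=1}^n A[1/fᵢ]` for some `f₁, …, fₙ ∈ A`"): `S` is `R`-isomorphic to a
finite product of principal localizations of `R`. [cite: BhattScholze2015, §2.2 (before Lemma 2.2.3)] -/
def IsZariskiLocalization (R S : Type u) [CommRing R] [CommRing S] [Algebra R S] : Prop :=
  ∃ (n : ℕ) (f : Fin n → R), Nonempty (S ≃ₐ[R] (Π i, Localization.Away (f i)))

/-- A principal localization is a Zariski localization (`n = 1`). [folklore] -/
theorem isZariskiLocalization_away (R : Type u) [CommRing R] (r : R) :
    IsZariskiLocalization R (Localization.Away r) :=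
  ⟨1, fun _ => r, ⟨(AlgEquiv.funUnique R (Fin 1) (Localization.Away r)).symm⟩⟩

/-- **Zariski localizations are étale** (principal localizations are étale and finite products of
étale algebras are étale; Mathlib `Algebra.Etale.of_isLocalizationAway`, `RingTheory/Etale/Pi`).
[folklore] -/
theorem IsZariskiLocalization.etale {R S : Type u} [CommRing R] [CommRing S] [Algebra R S]
    (h : IsZariskiLocalization R S) : Algebra.Etale R S := by
  obtain ⟨n, f, ⟨e⟩⟩ := h
  haveI : ∀ i, Algebra.Etale R (Localization.Away (f i)) := fun i =>
    Algebra.Etale.of_isLocalizationAway (f i)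
  exact Algebra.Etale.of_equiv e.symm

/-- **Ind-(Zariski localizations)** (Bhatt–Scholze §2.2: "a filtered colimit of Zariski
localizations"): `S` is `R`-isomorphic to a directed colimit of Zariski localizations of `R`.
[cite: BhattScholze2015, §2.2 (before Lemma 2.2.3)] -/
def IsIndZariskiLocalization (R S : Type u) [CommRing R] [CommRing S] [Algebra R S] : Prop :=
  ∃ (ι : Type u) (_ : Preorder ι) (_ : Nonempty ι) (_ : IsDirectedOrder ι)
    (G : ι → Type u) (_ : ∀ i, CommRing (G i)) (_ : ∀ i, Algebra R (G i))
    (_ : ∀ i, IsZariskiLocalization R (G i))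
    (f : ∀ i j, i ≤ j → G i →ₐ[R] G j) (_ : DirectedSystem G (f · · ·)),
    Nonempty (DirectLimit G f ≃ₐ[R] S)

/-- A Zariski localization is an ind-(Zariski localization) (the constant system). [folklore] -/
theorem IsZariskiLocalization.isIndZariskiLocalization {R S : Type u} [CommRing R] [CommRing S]
    [Algebra R S] (h : IsZariskiLocalization R S) : IsIndZariskiLocalization R S := by
  let f : ∀ i j : PUnit.{u + 1}, i ≤ j → S →ₐ[R] S := fun _ _ _ => AlgHom.id R S
  haveI hf : DirectedSystem (fun _ : PUnit.{u + 1} => S) (f · · ·) :=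
    ⟨fun _ _ => rfl, fun _ _ _ _ _ _ => rfl⟩
  refine ⟨PUnit.{u + 1}, inferInstance, inferInstance, inferInstance, fun _ => S, inferInstance,
    inferInstance, fun _ => h, f, hf, ⟨?_⟩⟩
  refine AlgEquiv.ofBijective (DirectLimit.Algebra.lift _ _ S (fun _ => AlgHom.id R S)
    (fun _ _ _ _ => rfl)) ⟨?_, fun s => ⟨DirectLimit.Algebra.of _ _ PUnit.unit s, rfl⟩⟩
  intro x y hxy
  obtain ⟨⟨⟩, x, rfl⟩ := DirectLimit.exists_eq_mk _ x
  obtain ⟨⟨⟩, y, rfl⟩ := DirectLimit.exists_eq_mk _ y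
  exact congrArg _ (congrArg _ hxy)

/-- **Ind-(Zariski localizations) are ind-étale** (the step "Lemma 2.3.8 shows that `f'` is an
ind-(Zariski localization). Setting `C = B'` then proves the claim" of the proof of Bhatt–Scholze
Thm. 2.3.4). [cite: BhattScholze2015, Thm. 2.3.4 (proof)] -/
theorem IsIndZariskiLocalization.isIndEtale {R S : Type u} [CommRing R] [CommRing S] [Algebra R S]
    (h : IsIndZariskiLocalization R S) : IsIndEtale R S := by
  obtain ⟨ι, _, _, _, G, _, _, hG, f, hf, e⟩ := h
  exact ⟨ι, inferInstance, inferInstance, inferInstance, G, inferInstance, inferInstance,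
    fun i => (hG i).etale, f, hf, e⟩

/-- In particular ind-(Zariski localizations) are weakly étale. [cite: BhattScholze2015, Prop. 2.3.3] -/
theorem IsIndZariskiLocalization.weaklyEtale_specMap {R S : Type u} [CommRing R] [CommRing S]
    [Algebra R S] (h : IsIndZariskiLocalization R S) :
    AlgebraicGeometry.WeaklyEtale
      (AlgebraicGeometry.Spec.map (CommRingCat.ofHom (algebraMap R S))) :=
  h.isIndEtale.weaklyEtale_specMap

end Zariski

end Literature.AlgebraicGeometry.Motives
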